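import Literature.AnabelianGeometry.EtaleTheta.Discharge.Sec5Prop55PullRootAndCodOfBiKummerDataGalois
import Literature.AnabelianGeometry.EtaleTheta.Discharge.Sec5ThetaSectionCompatOfKummerClass
import HarnessLib

/-!
# [EtTh] Prop. 5.5 leaf P55-L06c / GAP G-L6t23-3 (`hKR`): the Galois-equivariance of the root's bi-Kummer cocycle FROM THE DICTIONARY and
# FROM THE PIN, at `ofBiKummerData` / `ofConnectedTemperoidData`, ON THE v2 SUBQUOTIENT RECORD `ThetaSubquotientProjGalois` — PROOF-ONLY

S. Mochizuki, *The étale theta function and its Frobenioid-theoretic manifestations*, Publ. RIMS **45** (2009)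
[cite: MochizukiEtTh2009, Prop 5.5 proof p.327–328 (PDF pp.101–102); Prop 5.2 (iii) p.324 (PDF p.98); §5 p.330–331 (PDF pp.104–105);
§5 p.327 (PDF p.101) «these subquotients determine subquotients `Aut_D(D) ↠ Aut^Θ_D(D)`»].
abc-iut cell, layer L2, seat abc-iut-w6-d020 (gen 7), row «(w4-S) V1→V2 PORT — deep EndKnit*/AllLeavesV3*/KummerComparisonInputsLevel*
heads» (abc-iut-L2-lead gen 7 R957), layer S2c = the `hKR` producers consumed by the all-leaves knits over `B^temp(Π^tp_X)⁰` and by the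
AllLeavesV3* heads.

WHY.  abc-iut-L2-t11's `hcup_of_dictionary` / `hKR_ofBiKummerData_of_dictionary` (`Sec5KummerRootEquivariance`) and abc-iut-L6-t23's
`hKR_ofBiKummerData_of_thetaPairKummerClass` / `hKR_ofBiKummerData_of_pin` / `hKR_ofConnectedTemperoidData_of_pin`
(`Sec5ThetaSectionCompatOfKummerClass`) bind abc-iut-L2-t4's v1 record `(P : FrobenioidCyclotomicRigidity.ThetaSubquotientProj 𝔉)` (surjective
at EVERY base object; EMPTY at the root model for `l` odd, p456572 / p476337) — through the QUALIFIED binder, which the first (w4) censuses did not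
grep.  abc-iut-w6-d079's v2 record `ThetaSubquotientProjGalois 𝔉 Gal` (p481123) is INHABITED at every `ofSetting` carrier (p481568) and at
every level stub (p486065); every theorem here reads `P` only through `P.pre`.

THIS FILE re-keys the five theorems on the v2 record — binder `{Gal} (P : ThetaSubquotientProjGalois 𝔉 Gal)`, statements otherwise and proofs
VERBATIM (no `proj_surjective`), names = originals + `_galois`; consumed BY NAME: this seat's S1b twin `hcup_iff_pull_root_mul_galois`
(`Sec5Prop55PullRootAndCodOfBiKummerDataGalois`), the `P`-free dictionary lemmas (`diffCocycle_conj_eq_of_dictionary`,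
`exists_thetaSectionCompat_of_thetaPairKummerClass`, `baseMap_strvOfBiKummerData`, `coe_fracOfModel_mul_unit`, …).  0 `def`s; no v1 file edited;
the v1 heads are the `P.toGalois Gal` instances.

HONEST FRAMING: a typing repair of the cell's OWN record (weaker quantifier on `P`, as print uses it); kernel-checked implications between typed
statements over abc-iut-L2-t4's assembled §5 data; nothing of [EtTh] (refereed) is asserted; typed ≠ discharged; nothing here bears on [IUTchIII]
Cor. 3.12 — no side taken; nothing here asserts abc proved or refuted.
-/

noncomputable section

namespace Literature.AnabelianGeometry.EtaleTheta

open CategoryTheory Opposite FrobenioidCyclotomicRigidity Literature.AlgebraicGeometry.Frobenioids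

universe w v v' u u'

namespace ThetaFrobenioid

/-! ### (1) `hcup` from the dictionary — abstract §5 data, v2 record -/

section Generic

variable {C : Type u} [Category.{v} C] {D : Type u'} [Category.{v'} D] (𝔉 : ThetaFrobenioid.{w} C D)
  {l' : ℕ} (RD : RigidData.{v} 𝔉.N l') (H : 𝔉.Facts) (ι : 𝔉.PiX ≃* RD.PiX)
  (m : 𝔉.muTorsion 𝔉.BN 𝔉.N ≃* RD.mu) (hYdd : 𝔉.IdentifiesPiYdd RD.toThetaEnvData ι) {Gal : D → Prop}

/-- (v2 record `ThetaSubquotientProjGalois`; the v1 theorem `hcup_of_dictionary` VERBATIM — binder type + twin names only.) **`hcup` FROM THE DICTIONARY** (VERBATIM the binder of `Thm56Sub.cyclotomicRigidity_of_laws_galois` /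
`cyclotomicRigidity_ofBiKummerData_of_laws_galois`, SUBDAG-EtTh-Thm56 leaf P55-L06c): for every `g ∈ Aut_D(B_N^bs)` and `k ∈ H_{B_N}` over
`(l·Δ_Θ)_{B_N}` (`k ∈ P.pre`), `g k g⁻¹ ∈ H_{B_N}` and `s^⊔-gp_N(g k g⁻¹) = s^⊓-gp_N(g) · s^⊔-gp_N(k) · s^⊓-gp_N(g)⁻¹` — given the
dictionary (`ThetaSectionCompat`, `CyclotomicCharacterCompatX`) and the coverage `hcov` of the `(l·Δ_Θ)`-part of `H_{B_N}` by
`Π^tp_Ÿ̲ ∩ ι⁻¹(l·Δ_Θ)` (GAP G-w5d123-2 family).  [cite: MochizukiEtTh2009, Prop 5.5 proof p.327–328 (PDF pp.101–102)] -/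
theorem hcup_of_dictionary_galois {η : RD.PiYdd → RD.mu} (hη : η ∈ RD.thetaCocycles)
    (hcompat : 𝔉.ThetaSectionCompat H RD.toThetaEnvData ι m hYdd η)
    (hχX : 𝔉.CyclotomicCharacterCompatX RD.toThetaEnvData ι m)
    (P : ThetaSubquotientProjGalois 𝔉 Gal)
    (hcov : ∀ k : 𝔉.HB, (k : Aut (𝔉.base.obj 𝔉.BN)) ∈ P.pre _ →
      ∃ (y : 𝔉.PiX) (_ : y ∈ 𝔉.PiYdd), 𝔉.ρ y = k ∧ (ι y : RD.PiX) ∈ RD.lDeltaTheta) :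
    ∀ (g : Aut (𝔉.base.obj 𝔉.BN)) (k : 𝔉.HB), (k : Aut (𝔉.base.obj 𝔉.BN)) ∈ P.pre _ →
      ∃ hmem : g * (k : Aut (𝔉.base.obj 𝔉.BN)) * g⁻¹ ∈ 𝔉.HB,
        𝔉.sgpCup ⟨g * (k : Aut (𝔉.base.obj 𝔉.BN)) * g⁻¹, hmem⟩ = 𝔉.sgpCap g * 𝔉.sgpCup k * (𝔉.sgpCap g)⁻¹ := by
  intro g k hk
  obtain ⟨y, hy, hyk, hθ⟩ := hcov k hk
  obtain ⟨y₀, rfl⟩ := 𝔉.ρ_surjective g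
  have hk' : k = 𝔉.rhoYdd ⟨y, hy⟩ := Subtype.ext hyk.symm
  subst hk'
  have hmem : 𝔉.ρ y₀ * ((𝔉.rhoYdd ⟨y, hy⟩ : 𝔉.HB) : Aut (𝔉.base.obj 𝔉.BN)) * (𝔉.ρ y₀)⁻¹ ∈ 𝔉.HB :=
    ⟨y₀ * y * y₀⁻¹, 𝔉.PiYdd_normal.conj_mem _ hy y₀, by rw [map_mul, map_mul, map_inv]; rfl⟩
  refine ⟨hmem, ?_⟩
  rw [𝔉.sgpCup_conj_eq_iff]
  -- both sides are inverses of the two sides of `diffCocycle_conj_eq_of_dictionary`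
  have key := 𝔉.diffCocycle_conj_eq_of_dictionary RD H ι m hYdd hη hcompat hχX y₀ y hy hθ
  have eL : ((𝔉.diffCocycle H ⟨y₀ * y * y₀⁻¹, 𝔉.PiYdd_normal.conj_mem _ hy y₀⟩ : 𝔉.muTorsion 𝔉.BN 𝔉.N) :
        Aut 𝔉.BN) =
      𝔉.sgpCup ⟨𝔉.ρ y₀ * ((𝔉.rhoYdd ⟨y, hy⟩ : 𝔉.HB) : Aut (𝔉.base.obj 𝔉.BN)) * (𝔉.ρ y₀)⁻¹, hmem⟩ *
        (𝔉.sgpCap (𝔉.ρ y₀ * ((𝔉.rhoYdd ⟨y, hy⟩ : 𝔉.HB) : Aut (𝔉.base.obj 𝔉.BN)) * (𝔉.ρ y₀)⁻¹))⁻¹ := by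
    have e : 𝔉.rhoYdd ⟨y₀ * y * y₀⁻¹, 𝔉.PiYdd_normal.conj_mem _ hy y₀⟩ =
        ⟨𝔉.ρ y₀ * ((𝔉.rhoYdd ⟨y, hy⟩ : 𝔉.HB) : Aut (𝔉.base.obj 𝔉.BN)) * (𝔉.ρ y₀)⁻¹, hmem⟩ :=
      Subtype.ext (by change 𝔉.ρ (y₀ * y * y₀⁻¹) = _; rw [map_mul, map_mul, map_inv]; rfl)
    change 𝔉.sgpCup (𝔉.rhoYdd _) * (𝔉.sgpCap (𝔉.rhoYdd _ : Aut (𝔉.base.obj 𝔉.BN)))⁻¹ = _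
    rw [e]
    rfl
  have eR : ((𝔉.diffCocycle H ⟨y, hy⟩ : 𝔉.muTorsion 𝔉.BN 𝔉.N) : Aut 𝔉.BN) =
      𝔉.sgpCup (𝔉.rhoYdd ⟨y, hy⟩) * (𝔉.sgpCap ((𝔉.rhoYdd ⟨y, hy⟩ : 𝔉.HB) : Aut (𝔉.base.obj 𝔉.BN)))⁻¹ := rfl
  rw [eL, eR] at key
  have key' := congrArg Inv.inv key
  simp only [mul_inv_rev, inv_inv] at key'
  rw [key']
  simp only [mul_assoc]


end Generic

/-! ### (2) `hKR` at `ofBiKummerData` from the dictionary / from the `(η, ν)`-pin — v2 record -/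

section OfBiKummerData

universe u₀ v₀ u₁ v₁ w₁

variable {K : Type u₀} [Field K] {X : SemiGraphs.TemperedArithmeticGroup.{u₀} K} {D₀ : Type u₀} [Category.{v₀} D₀]
  {V : FrdIMonoidStub.{w₁}} {T₀ : RealifiedDivisorMonoids (D₀ := D₀) V} {D : Type u₁} [Category.{v₁} D]
  {VD : FrdICatStub.{u₁, v₁, w₁} D} {S : BiKummerSetting X T₀ D VD}
  {pullFrac : ∀ {A A' : S.C} (_ : A' ⟶ A), S.biratUnits A → S.biratUnits A'}
  {lv N : ℕ+} {l' : ℕ} {RD : RigidData.{max v₁ w₁} N l'} {θ : S.biratUnits S.Aodot} {Bl : S.C}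
  {Pl : S.FractionPair θ Bl} {Rl : S.NthRoot θ Pl lv pullFrac}
  (h : ModelFrobenioid.Hypotheses S.tf.divisorMonoid S.tf.ratFnFunctor)
  (toB : ∀ A : S.C, S.biratUnits A →* S.tf.biratUnitsModel A) (Q : FrobenioidTheta.ThetaSubquotientStub.{w₁} D)
  (odd_l : Odd (lv : ℕ)) (R : S.NthRoot Rl.root Rl.pair N pullFrac) (ιX : RD.PiX ≃ₜ* X.Pi)
  (hopen : IsOpen ((S.galoisSurj R.AN.base R.αData.isGalois).ker : Set X.Pi)) (σ : Aut R.AN.base →* Aut R.AN)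
  (K' : Type w₁) [Field K'] (constEmb : K'ˣ →* S.tf.biratUnitsModel R.BN)
  (constEmb_injective : Function.Injective constEmb)
  (hdivc : ∀ g : Aut R.BN.base,
    ModelFrobenioid.div ((σ ((BiKummerSetting.NthRoot.baseIso S R).conjAut.symm g)).hom ≫ R.pair.num) =
      ModelFrobenioid.div R.pair.num)
  (hdivp : ∀ y : RD.PiYdd,
    ModelFrobenioid.div ((σ (S.galoisSurj R.AN.base R.αData.isGalois (ιX y.1))).hom ≫ R.pair.den) =
      ModelFrobenioid.div R.pair.den)
  {Gal : D → Prop}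

/-- (v2 record `ThetaSubquotientProjGalois`; the v1 theorem `hKR_ofBiKummerData_of_dictionary` VERBATIM — binder type + twin names only.) **GAP row G-L6t23-3 (`hKR`) FROM THE DICTIONARY, at the assembled data `ofBiKummerData`**: the Kummer cocycle
`c(γ) = γ^* x / x` of the `N`-th root (`x = toB R.AN R.root`) is multiplicative at `(ρ_{A_N}(ιX y₀), ρ_{A_N}(ιX y))` for every
`y₀ ∈ Π^tp_X̲` and every `y ∈ Π^tp_Ÿ̲` over `(l·Δ_Θ)` — abc-iut-L6-t23's equivalence `hcup_iff_pull_root_mul_galois` applied to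
`hcup_of_dictionary_galois` for the §2 datum `RD` itself (`ι := id`).  Inputs: the [FrdI] Prop. 5.6 / Thm. 5.2 (ii) laws `hσ`, `hfrac` of
the data; the dictionary `m`, `ThetaSectionCompat`, `CyclotomicCharacterCompatX`; the coverage `hcov`.
[cite: MochizukiEtTh2009, Prop 5.5 proof p.327–328 (PDF pp.101–102)] -/
theorem hKR_ofBiKummerData_of_dictionary_galois
    (hσ : ∀ g : Aut R.AN.base, ModelFrobenioid.baseMap (σ g).hom = g.hom)
    (hfrac : ∀ {A B : S.C} (s' s'' : A ⟶ B) (h' : S.IsPreStep s') (h'' : S.IsPreStep s'')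
      (hb : PreFrobenioid.BaseEquivalent S.F s' s''),
      (toB A (S.fracOf s' s'' h' h'' hb) : S.tf.ratFnFunctor.obj (op A.base)) *
        ModelFrobenioid.unit s'' = ModelFrobenioid.unit s')
    (P : ThetaSubquotientProjGalois
      (ofBiKummerData h toB Q odd_l R ιX hopen σ K' constEmb constEmb_injective hdivc hdivp) Gal)
    (H : (ofBiKummerData h toB Q odd_l R ιX hopen σ K' constEmb constEmb_injective hdivc hdivp).Facts)
    (m : (ofBiKummerData h toB Q odd_l R ιX hopen σ K' constEmb constEmb_injective hdivc hdivp).muTorsion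
        (ofBiKummerData h toB Q odd_l R ιX hopen σ K' constEmb constEmb_injective hdivc hdivp).BN
        (ofBiKummerData h toB Q odd_l R ιX hopen σ K' constEmb constEmb_injective hdivc hdivp).N ≃* RD.mu)
    (hYdd : (ofBiKummerData h toB Q odd_l R ιX hopen σ K' constEmb constEmb_injective hdivc hdivp).IdentifiesPiYdd
      RD.toThetaEnvData (MulEquiv.refl _))
    {η : RD.PiYdd → RD.mu} (hη : η ∈ RD.thetaCocycles)
    (hcompat : (ofBiKummerData h toB Q odd_l R ιX hopen σ K' constEmb constEmb_injective hdivc hdivp).ThetaSectionCompat H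
      RD.toThetaEnvData (MulEquiv.refl _) m hYdd η)
    (hχX : (ofBiKummerData h toB Q odd_l R ιX hopen σ K' constEmb constEmb_injective hdivc hdivp).CyclotomicCharacterCompatX
      RD.toThetaEnvData (MulEquiv.refl _) m)
    (hcov : ∀ k : (ofBiKummerData h toB Q odd_l R ιX hopen σ K' constEmb constEmb_injective hdivc hdivp).HB,
      (k : Aut ((ofBiKummerData h toB Q odd_l R ιX hopen σ K' constEmb constEmb_injective hdivc hdivp).base.obj
        (ofBiKummerData h toB Q odd_l R ιX hopen σ K' constEmb constEmb_injective hdivc hdivp).BN)) ∈ P.pre _ →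
      ∃ (y : RD.PiX) (_ : y ∈ RD.PiYdd),
        (ofBiKummerData h toB Q odd_l R ιX hopen σ K' constEmb constEmb_injective hdivc hdivp).ρ y = k ∧
          y ∈ RD.lDeltaTheta) :
    ∀ (y₀ y : RD.PiX), y ∈ RD.PiYdd → rhoOfBiKummerData R ιX y ∈ P.pre R.BN.base →
      pull S.tf.ratFnFunctor (S.galoisSurj R.AN.base R.αData.isGalois (ιX y)).hom
          (pull S.tf.ratFnFunctor (S.galoisSurj R.AN.base R.αData.isGalois (ιX y₀)).hom
            (toB R.AN R.root : S.tf.ratFnFunctor.obj (op R.AN.base))) *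
          (toB R.AN R.root : S.tf.ratFnFunctor.obj (op R.AN.base)) =
        pull S.tf.ratFnFunctor (S.galoisSurj R.AN.base R.αData.isGalois (ιX y)).hom
            (toB R.AN R.root : S.tf.ratFnFunctor.obj (op R.AN.base)) *
          pull S.tf.ratFnFunctor (S.galoisSurj R.AN.base R.αData.isGalois (ιX y₀)).hom
            (toB R.AN R.root : S.tf.ratFnFunctor.obj (op R.AN.base)) :=
  (hcup_iff_pull_root_mul_galois h toB Q odd_l R ιX hopen σ K' constEmb constEmb_injective hdivc hdivp hσ hfrac P).mp
    ((ofBiKummerData h toB Q odd_l R ιX hopen σ K' constEmb constEmb_injective hdivc hdivp).hcup_of_dictionary_galois RD H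
      (MulEquiv.refl _) m hYdd hη hcompat hχX P hcov)


/-- (v2 record `ThetaSubquotientProjGalois`; the v1 theorem `hKR_ofBiKummerData_of_thetaPairKummerClass` VERBATIM — binder type + twin names only.) **G-L6t23-3 (`hKR`) at `ofBiKummerData` FROM THE `(η, ν)`-PIN**: abc-iut-L2-t11's `hKR_ofBiKummerData_of_dictionary_galois` with
`hYdd` DISCHARGED (`Π^tp_Ÿ̲ = Π^tp_Ÿ` definitionally, `ι = id`) and F-0521 `ThetaSectionCompat` PRODUCED from abc-iut-L2-t4's
`ThetaPairKummerClass` for an `η` pinned to the theta cocycle `η₀` through `m`/`ν` (`exists_thetaSectionCompat_of_thetaPairKummerClass`).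
Inputs: `hσ`, `hfrac` ([FrdI] Prop. 5.6 / Thm. 5.2 (ii) laws of the data); `H : Facts`; the cyclotome dictionary `m` with
`CyclotomicCharacterCompatX`; the pin `hη₀`, `hpin`, `hKC`; the coverage `hcov` (GAP G-w5d123-2 family).
[cite: MochizukiEtTh2009, Prop 5.5 proof p.327–328 (PDF pp.101–102); Prop 5.2 (iii) p.324 (PDF p.98)] -/
theorem hKR_ofBiKummerData_of_thetaPairKummerClass_galois
    (hσ : ∀ g : Aut R.AN.base, ModelFrobenioid.baseMap (σ g).hom = g.hom)
    (hfrac : ∀ {A B : S.C} (s' s'' : A ⟶ B) (h' : S.IsPreStep s') (h'' : S.IsPreStep s'')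
      (hb : PreFrobenioid.BaseEquivalent S.F s' s''),
      (toB A (S.fracOf s' s'' h' h'' hb) : S.tf.ratFnFunctor.obj (op A.base)) *
        ModelFrobenioid.unit s'' = ModelFrobenioid.unit s')
    (P : ThetaSubquotientProjGalois
      (ofBiKummerData h toB Q odd_l R ιX hopen σ K' constEmb constEmb_injective hdivc hdivp) Gal)
    (H : (ofBiKummerData h toB Q odd_l R ιX hopen σ K' constEmb constEmb_injective hdivc hdivp).Facts)
    (m : (ofBiKummerData h toB Q odd_l R ιX hopen σ K' constEmb constEmb_injective hdivc hdivp).muTorsion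
        (ofBiKummerData h toB Q odd_l R ιX hopen σ K' constEmb constEmb_injective hdivc hdivp).BN
        (ofBiKummerData h toB Q odd_l R ιX hopen σ K' constEmb constEmb_injective hdivc hdivp).N ≃* RD.mu)
    (hχX : (ofBiKummerData h toB Q odd_l R ιX hopen σ K' constEmb constEmb_injective hdivc hdivp).CyclotomicCharacterCompatX
      RD.toThetaEnvData (MulEquiv.refl _) m)
    {η₀ : RD.PiYdd → RD.mu} (hη₀ : η₀ ∈ RD.thetaCocycles)
    (ν : (ofBiKummerData h toB Q odd_l R ιX hopen σ K' constEmb constEmb_injective hdivc hdivp).lDeltaModN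
        (ofBiKummerData h toB Q odd_l R ιX hopen σ K' constEmb constEmb_injective hdivc hdivp).BN ≃*
      (ofBiKummerData h toB Q odd_l R ιX hopen σ K' constEmb constEmb_injective hdivc hdivp).muTorsion
        (ofBiKummerData h toB Q odd_l R ιX hopen σ K' constEmb constEmb_injective hdivc hdivp).BN
        (ofBiKummerData h toB Q odd_l R ιX hopen σ K' constEmb constEmb_injective hdivc hdivp).N)
    (η : (ofBiKummerData h toB Q odd_l R ιX hopen σ K' constEmb constEmb_injective hdivc hdivp).HB →
      (ofBiKummerData h toB Q odd_l R ιX hopen σ K' constEmb constEmb_injective hdivc hdivp).lDeltaModN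
        (ofBiKummerData h toB Q odd_l R ιX hopen σ K' constEmb constEmb_injective hdivc hdivp).BN)
    (hpin : ∀ k : RD.PiYdd, m (ν (η ⟨rhoOfBiKummerData R ιX k, Subgroup.mem_map_of_mem _ k.2⟩)) = η₀ k)
    (hKC : FrobenioidThetaBiKummer.ThetaPairKummerClass
      (ofBiKummerData h toB Q odd_l R ιX hopen σ K' constEmb constEmb_injective hdivc hdivp) η ν)
    (hcov : ∀ k : (ofBiKummerData h toB Q odd_l R ιX hopen σ K' constEmb constEmb_injective hdivc hdivp).HB,
      (k : Aut ((ofBiKummerData h toB Q odd_l R ιX hopen σ K' constEmb constEmb_injective hdivc hdivp).base.obj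
        (ofBiKummerData h toB Q odd_l R ιX hopen σ K' constEmb constEmb_injective hdivc hdivp).BN)) ∈ P.pre _ →
      ∃ (y : RD.PiX) (_ : y ∈ RD.PiYdd),
        (ofBiKummerData h toB Q odd_l R ιX hopen σ K' constEmb constEmb_injective hdivc hdivp).ρ y = k ∧
          y ∈ RD.lDeltaTheta) :
    ∀ (y₀ y : RD.PiX), y ∈ RD.PiYdd → rhoOfBiKummerData R ιX y ∈ P.pre R.BN.base →
      pull S.tf.ratFnFunctor (S.galoisSurj R.AN.base R.αData.isGalois (ιX y)).hom
          (pull S.tf.ratFnFunctor (S.galoisSurj R.AN.base R.αData.isGalois (ιX y₀)).hom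
            (toB R.AN R.root : S.tf.ratFnFunctor.obj (op R.AN.base))) *
          (toB R.AN R.root : S.tf.ratFnFunctor.obj (op R.AN.base)) =
        pull S.tf.ratFnFunctor (S.galoisSurj R.AN.base R.αData.isGalois (ιX y)).hom
            (toB R.AN R.root : S.tf.ratFnFunctor.obj (op R.AN.base)) *
          pull S.tf.ratFnFunctor (S.galoisSurj R.AN.base R.αData.isGalois (ιX y₀)).hom
            (toB R.AN R.root : S.tf.ratFnFunctor.obj (op R.AN.base)) := by
  obtain ⟨η₁, hη₁, hcompat⟩ :=
    (ofBiKummerData h toB Q odd_l R ιX hopen σ K' constEmb constEmb_injective hdivc hdivp)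
      |>.exists_thetaSectionCompat_of_thetaPairKummerClass RD H (MulEquiv.refl _) m (fun _ => Iff.rfl) hχX hη₀ ν η
        (fun k => hpin k) hKC
  exact hKR_ofBiKummerData_of_dictionary_galois h toB Q odd_l R ιX hopen σ K' constEmb constEmb_injective hdivc hdivp hσ hfrac P H
    m (fun _ => Iff.rfl) hη₁ hcompat hχX hcov

/-- (v2 record `ThetaSubquotientProjGalois`; the v1 theorem `hKR_ofBiKummerData_of_pin` VERBATIM — binder type + twin names only.) **G-L6t23-3 (`hKR`) at `ofBiKummerData` FROM THE PIN BINDERS of the Prop. 5.5 chain** — `hη₀ hdies e hK` VERBATIM as taken by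
abc-iut-w5-d020's `cyclotomicRigidity_ofBiKummerData_of_laws_galois` / this lineage's `cyclotomicRigidity_ofBiKummerData_connectedPart_of_pullRoot`
(the descended `η` on `H_{B_N}` exists by abc-iut-w5-d123's `ThetaEnvData.exists_descent_thetaCocycle` under `hdies`), plus ONE
normalisation `hme : m ∘ ν ∘ e = id` of abc-iut-L2-t11's cyclotome dictionary `m` against abc-iut-L2-t4's `(e, ν)`.
[cite: MochizukiEtTh2009, Prop 5.5 proof p.327–328 (PDF pp.101–102); Prop 5.2 (iii) p.324 (PDF p.98)] -/
theorem hKR_ofBiKummerData_of_pin_galois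
    (hσ : ∀ g : Aut R.AN.base, ModelFrobenioid.baseMap (σ g).hom = g.hom)
    (hfrac : ∀ {A B : S.C} (s' s'' : A ⟶ B) (h' : S.IsPreStep s') (h'' : S.IsPreStep s'')
      (hb : PreFrobenioid.BaseEquivalent S.F s' s''),
      (toB A (S.fracOf s' s'' h' h'' hb) : S.tf.ratFnFunctor.obj (op A.base)) *
        ModelFrobenioid.unit s'' = ModelFrobenioid.unit s')
    (P : ThetaSubquotientProjGalois
      (ofBiKummerData h toB Q odd_l R ιX hopen σ K' constEmb constEmb_injective hdivc hdivp) Gal)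
    (H : (ofBiKummerData h toB Q odd_l R ιX hopen σ K' constEmb constEmb_injective hdivc hdivp).Facts)
    (m : (ofBiKummerData h toB Q odd_l R ιX hopen σ K' constEmb constEmb_injective hdivc hdivp).muTorsion
        (ofBiKummerData h toB Q odd_l R ιX hopen σ K' constEmb constEmb_injective hdivc hdivp).BN
        (ofBiKummerData h toB Q odd_l R ιX hopen σ K' constEmb constEmb_injective hdivc hdivp).N ≃* RD.mu)
    (hχX : (ofBiKummerData h toB Q odd_l R ιX hopen σ K' constEmb constEmb_injective hdivc hdivp).CyclotomicCharacterCompatX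
      RD.toThetaEnvData (MulEquiv.refl _) m)
    {η₀ : RD.PiYdd → RD.mu} (hη₀ : η₀ ∈ RD.thetaCocycles)
    (hdies : ∀ k : RD.PiYdd, rhoOfBiKummerData R ιX k = 1 → η₀ k = 1)
    (e : RD.mu → (ofBiKummerData h toB Q odd_l R ιX hopen σ K' constEmb constEmb_injective hdivc hdivp).lDeltaModN
      (ofBiKummerData h toB Q odd_l R ιX hopen σ K' constEmb constEmb_injective hdivc hdivp).BN)
    (ν : (ofBiKummerData h toB Q odd_l R ιX hopen σ K' constEmb constEmb_injective hdivc hdivp).lDeltaModN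
        (ofBiKummerData h toB Q odd_l R ιX hopen σ K' constEmb constEmb_injective hdivc hdivp).BN ≃*
      (ofBiKummerData h toB Q odd_l R ιX hopen σ K' constEmb constEmb_injective hdivc hdivp).muTorsion
        (ofBiKummerData h toB Q odd_l R ιX hopen σ K' constEmb constEmb_injective hdivc hdivp).BN
        (ofBiKummerData h toB Q odd_l R ιX hopen σ K' constEmb constEmb_injective hdivc hdivp).N)
    (hme : ∀ x : RD.mu, m (ν (e x)) = x)
    (hK : ∀ η : (ofBiKummerData h toB Q odd_l R ιX hopen σ K' constEmb constEmb_injective hdivc hdivp).HB →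
        (ofBiKummerData h toB Q odd_l R ιX hopen σ K' constEmb constEmb_injective hdivc hdivp).lDeltaModN
          (ofBiKummerData h toB Q odd_l R ιX hopen σ K' constEmb constEmb_injective hdivc hdivp).BN,
      (∀ k : RD.PiYdd, η ⟨rhoOfBiKummerData R ιX k, Subgroup.mem_map_of_mem _ k.2⟩ = e (η₀ k)) →
        FrobenioidThetaBiKummer.ThetaPairKummerClass
          (ofBiKummerData h toB Q odd_l R ιX hopen σ K' constEmb constEmb_injective hdivc hdivp) η ν)
    (hcov : ∀ k : (ofBiKummerData h toB Q odd_l R ιX hopen σ K' constEmb constEmb_injective hdivc hdivp).HB,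
      (k : Aut ((ofBiKummerData h toB Q odd_l R ιX hopen σ K' constEmb constEmb_injective hdivc hdivp).base.obj
        (ofBiKummerData h toB Q odd_l R ιX hopen σ K' constEmb constEmb_injective hdivc hdivp).BN)) ∈ P.pre _ →
      ∃ (y : RD.PiX) (_ : y ∈ RD.PiYdd),
        (ofBiKummerData h toB Q odd_l R ιX hopen σ K' constEmb constEmb_injective hdivc hdivp).ρ y = k ∧
          y ∈ RD.lDeltaTheta) :
    ∀ (y₀ y : RD.PiX), y ∈ RD.PiYdd → rhoOfBiKummerData R ιX y ∈ P.pre R.BN.base →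
      pull S.tf.ratFnFunctor (S.galoisSurj R.AN.base R.αData.isGalois (ιX y)).hom
          (pull S.tf.ratFnFunctor (S.galoisSurj R.AN.base R.αData.isGalois (ιX y₀)).hom
            (toB R.AN R.root : S.tf.ratFnFunctor.obj (op R.AN.base))) *
          (toB R.AN R.root : S.tf.ratFnFunctor.obj (op R.AN.base)) =
        pull S.tf.ratFnFunctor (S.galoisSurj R.AN.base R.αData.isGalois (ιX y)).hom
            (toB R.AN R.root : S.tf.ratFnFunctor.obj (op R.AN.base)) *
          pull S.tf.ratFnFunctor (S.galoisSurj R.AN.base R.αData.isGalois (ιX y₀)).hom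
            (toB R.AN R.root : S.tf.ratFnFunctor.obj (op R.AN.base)) := by
  obtain ⟨η, hη⟩ := RD.toThetaEnvData.exists_descent_thetaCocycle (rhoOfBiKummerData R ιX) hη₀ hdies e
  exact hKR_ofBiKummerData_of_thetaPairKummerClass_galois h toB Q odd_l R ιX hopen σ K' constEmb constEmb_injective hdivc hdivp hσ
    hfrac P H m hχX hη₀ ν η (fun k => (congrArg (fun z => m (ν z)) (hη k)).trans (hme (η₀ k))) (hK η hη) hcov

end OfBiKummerData

/-! ### (3) `hKR` at the genuine connected data `ofConnectedTemperoidData` from the pin — v2 record -/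

section OfConnectedTemperoidData

open Literature.AnabelianGeometry.SemiGraphs Literature.AlgebraicGeometry.Frobenioids.QuasiTemperoid.BTempConnected

universe u₀ v₀

variable {K : Type u₀} [Field K] {X : SemiGraphs.TemperedArithmeticGroup.{u₀} K} {D₀ : Type u₀} [Category.{v₀} D₀]
  {V : FrdIMonoidStub.{w}} {T₀ : RealifiedDivisorMonoids (D₀ := D₀) V}
  {VD : FrdICatStub.{u₀ + 1, u₀, w} (ConnectedPart (BTemp X.Pi))}
  {tf : TemperedFrobenioid T₀ (ConnectedPart (BTemp X.Pi)) VD} {hZ : tf.monoidType = MonoidType.Z}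
  {hP : ∀ A : (ConnectedPart (BTemp X.Pi))ᵒᵖ, IsPerfect (tf.Φ.carrier A)}
  {NH : Subgroup (Field.absoluteGaloisGroup K) → tf.category → ℕ+ → Prop} {A₀ : tf.category}
  {hA₀ : PreFrobenioid.IsFrobeniusTrivial tf.toElem A₀} {hA₀' : SemiGraphs.IsGaloisObj A₀.base.obj}
  {pullFrac : ∀ {A A' : (BiKummerSetting.mkOfConnectedTemperoid X tf hZ hP NH A₀ hA₀ hA₀').C} (_ : A' ⟶ A),
    (BiKummerSetting.mkOfConnectedTemperoid X tf hZ hP NH A₀ hA₀ hA₀').biratUnits A →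
      (BiKummerSetting.mkOfConnectedTemperoid X tf hZ hP NH A₀ hA₀ hA₀').biratUnits A'}
  {lv N : ℕ+} {l' : ℕ} {RD : RigidData.{max u₀ w} N l'}
  {θ : (BiKummerSetting.mkOfConnectedTemperoid X tf hZ hP NH A₀ hA₀ hA₀').biratUnits
    (BiKummerSetting.mkOfConnectedTemperoid X tf hZ hP NH A₀ hA₀ hA₀').Aodot}
  {Bl : (BiKummerSetting.mkOfConnectedTemperoid X tf hZ hP NH A₀ hA₀ hA₀').C}
  {Pl : (BiKummerSetting.mkOfConnectedTemperoid X tf hZ hP NH A₀ hA₀ hA₀').FractionPair θ Bl}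
  {Rl : (BiKummerSetting.mkOfConnectedTemperoid X tf hZ hP NH A₀ hA₀ hA₀').NthRoot θ Pl lv pullFrac}
  (h : ModelFrobenioid.Hypotheses tf.divisorMonoid tf.ratFnFunctor)
  (Q : FrobenioidTheta.ThetaSubquotientStub.{w} (ConnectedPart (BTemp X.Pi))) (odd_l : Odd (lv : ℕ))
  (R : (BiKummerSetting.mkOfConnectedTemperoid X tf hZ hP NH A₀ hA₀ hA₀').NthRoot Rl.root Rl.pair N pullFrac)
  (ιX : RD.PiX ≃ₜ* X.Pi) (K' : Type w) [Field K'] (constEmb : K'ˣ →* tf.biratUnitsModel R.BN)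
  (constEmb_injective : Function.Injective constEmb)
  (hinvc : ∀ g : Aut R.AN.base,
    pull tf.divisorMonoid g.hom (ModelFrobenioid.div R.pair.num) = ModelFrobenioid.div R.pair.num)
  (hinvp : ∀ y : RD.PiX, y ∈ RD.PiYdd →
    pull tf.divisorMonoid ((BiKummerSetting.mkOfConnectedTemperoid X tf hZ hP NH A₀ hA₀ hA₀').galoisSurj R.AN.base
      R.αData.isGalois (ιX y)).hom (ModelFrobenioid.div R.pair.den) = ModelFrobenioid.div R.pair.den)
  {Gal : ConnectedPart (BTemp X.Pi) → Prop}

/-- (v2 record `ThetaSubquotientProjGalois`; the v1 theorem `hKR_ofConnectedTemperoidData_of_pin` VERBATIM — binder type + twin names only.) **G-L6t23-3 (`hKR`) at the GENUINE connected data `ofConnectedTemperoidData`** (abc-iut-L2-t4, `A_⊙`, roots, constants over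
`D := B^temp(Π^tp_X)⁰`, dictionary `toB = id`, `σ = s^trv_N` constructed): `hKR_ofBiKummerData_of_pin_galois` with `hσ := baseMap_strvOfBiKummerData`
and `hfrac := coe_fracOfModel_mul_unit` DISCHARGED ([FrdI] Prop. 5.6 section / Thm. 5.2 (ii) dictionary — theorems of the model).  Residual
inputs: the pin `{hη₀, hdies, e, hme, hK}`, `H : Facts`, the cyclotome dictionary `m` with `CyclotomicCharacterCompatX`, the coverage `hcov`.
[cite: MochizukiEtTh2009, Prop 5.5 proof p.327–328 (PDF pp.101–102); §5 p.330–331 (PDF pp.104–105)] -/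
theorem hKR_ofConnectedTemperoidData_of_pin_galois
    (P : ThetaSubquotientProjGalois
      (ofConnectedTemperoidData h Q odd_l R ιX K' constEmb constEmb_injective hinvc hinvp) Gal)
    (H : (ofConnectedTemperoidData h Q odd_l R ιX K' constEmb constEmb_injective hinvc hinvp).Facts)
    (m : (ofConnectedTemperoidData h Q odd_l R ιX K' constEmb constEmb_injective hinvc hinvp).muTorsion
        (ofConnectedTemperoidData h Q odd_l R ιX K' constEmb constEmb_injective hinvc hinvp).BN
        (ofConnectedTemperoidData h Q odd_l R ιX K' constEmb constEmb_injective hinvc hinvp).N ≃* RD.mu)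
    (hχX : (ofConnectedTemperoidData h Q odd_l R ιX K' constEmb constEmb_injective hinvc hinvp).CyclotomicCharacterCompatX
      RD.toThetaEnvData (MulEquiv.refl _) m)
    {η₀ : RD.PiYdd → RD.mu} (hη₀ : η₀ ∈ RD.thetaCocycles)
    (hdies : ∀ k : RD.PiYdd, rhoOfBiKummerData R ιX k = 1 → η₀ k = 1)
    (e : RD.mu → (ofConnectedTemperoidData h Q odd_l R ιX K' constEmb constEmb_injective hinvc hinvp).lDeltaModN
      (ofConnectedTemperoidData h Q odd_l R ιX K' constEmb constEmb_injective hinvc hinvp).BN)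
    (ν : (ofConnectedTemperoidData h Q odd_l R ιX K' constEmb constEmb_injective hinvc hinvp).lDeltaModN
        (ofConnectedTemperoidData h Q odd_l R ιX K' constEmb constEmb_injective hinvc hinvp).BN ≃*
      (ofConnectedTemperoidData h Q odd_l R ιX K' constEmb constEmb_injective hinvc hinvp).muTorsion
        (ofConnectedTemperoidData h Q odd_l R ιX K' constEmb constEmb_injective hinvc hinvp).BN
        (ofConnectedTemperoidData h Q odd_l R ιX K' constEmb constEmb_injective hinvc hinvp).N)
    (hme : ∀ x : RD.mu, m (ν (e x)) = x)
    (hK : ∀ η : (ofConnectedTemperoidData h Q odd_l R ιX K' constEmb constEmb_injective hinvc hinvp).HB →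
        (ofConnectedTemperoidData h Q odd_l R ιX K' constEmb constEmb_injective hinvc hinvp).lDeltaModN
          (ofConnectedTemperoidData h Q odd_l R ιX K' constEmb constEmb_injective hinvc hinvp).BN,
      (∀ k : RD.PiYdd, η ⟨rhoOfBiKummerData R ιX k, Subgroup.mem_map_of_mem _ k.2⟩ = e (η₀ k)) →
        FrobenioidThetaBiKummer.ThetaPairKummerClass
          (ofConnectedTemperoidData h Q odd_l R ιX K' constEmb constEmb_injective hinvc hinvp) η ν)
    (hcov : ∀ k : (ofConnectedTemperoidData h Q odd_l R ιX K' constEmb constEmb_injective hinvc hinvp).HB,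
      (k : Aut ((ofConnectedTemperoidData h Q odd_l R ιX K' constEmb constEmb_injective hinvc hinvp).base.obj
        (ofConnectedTemperoidData h Q odd_l R ιX K' constEmb constEmb_injective hinvc hinvp).BN)) ∈ P.pre _ →
      ∃ (y : RD.PiX) (_ : y ∈ RD.PiYdd),
        (ofConnectedTemperoidData h Q odd_l R ιX K' constEmb constEmb_injective hinvc hinvp).ρ y = k ∧
          y ∈ RD.lDeltaTheta) :
    ∀ (y₀ y : RD.PiX), y ∈ RD.PiYdd → rhoOfBiKummerData R ιX y ∈ P.pre R.BN.base →
      pull tf.ratFnFunctor ((BiKummerSetting.mkOfConnectedTemperoid X tf hZ hP NH A₀ hA₀ hA₀').galoisSurj R.AN.base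
            R.αData.isGalois (ιX y)).hom
          (pull tf.ratFnFunctor ((BiKummerSetting.mkOfConnectedTemperoid X tf hZ hP NH A₀ hA₀ hA₀').galoisSurj R.AN.base
              R.αData.isGalois (ιX y₀)).hom
            (MonoidHom.id (tf.biratUnitsModel R.AN) R.root : tf.ratFnFunctor.obj (op R.AN.base))) *
          (MonoidHom.id (tf.biratUnitsModel R.AN) R.root : tf.ratFnFunctor.obj (op R.AN.base)) =
        pull tf.ratFnFunctor ((BiKummerSetting.mkOfConnectedTemperoid X tf hZ hP NH A₀ hA₀ hA₀').galoisSurj R.AN.base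
              R.αData.isGalois (ιX y)).hom
            (MonoidHom.id (tf.biratUnitsModel R.AN) R.root : tf.ratFnFunctor.obj (op R.AN.base)) *
          pull tf.ratFnFunctor ((BiKummerSetting.mkOfConnectedTemperoid X tf hZ hP NH A₀ hA₀ hA₀').galoisSurj R.AN.base
              R.αData.isGalois (ιX y₀)).hom
            (MonoidHom.id (tf.biratUnitsModel R.AN) R.root : tf.ratFnFunctor.obj (op R.AN.base)) := by
  delta ThetaFrobenioid.ofConnectedTemperoidData at P H m hχX e ν hK hcov
  exact hKR_ofBiKummerData_of_pin_galois (S := BiKummerSetting.mkOfConnectedTemperoid X tf hZ hP NH A₀ hA₀ hA₀')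
    (pullFrac := pullFrac) (RD := RD) (θ := θ) (Bl := Bl) (Pl := Pl) (Rl := Rl) h (fun _ => MonoidHom.id _) Q odd_l R ιX
    (BiKummerSetting.mkOfConnectedTemperoid_isOpen_ker_galoisSurj X tf hZ hP NH A₀ hA₀ hA₀' R.AN.base R.αData.isGalois)
    (strvOfBiKummerData h R) K' constEmb constEmb_injective
    (hdivc_of_pull_invariant h.isDivisorial R (strvOfBiKummerData h R) (baseMap_strvOfBiKummerData h R) hinvc)
    (hdivp_of_pull_invariant h.isDivisorial R ιX (strvOfBiKummerData h R) (baseMap_strvOfBiKummerData h R) hinvp)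
    (baseMap_strvOfBiKummerData h R) (fun s' s'' _ _ _ => BiKummerSetting.coe_fracOfModel_mul_unit tf T₀.isUnit_BΛ s' s'')
    P H m hχX hη₀ hdies e ν hme hK hcov

end OfConnectedTemperoidData

end ThetaFrobenioid

end Literature.AnabelianGeometry.EtaleTheta

end
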